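import Summits.QuantumFields.YangMills.Theorems.UnitScaleTiltProp7BlendCorners
import Summits.QuantumFields.YangMills.Theorems.UnitScaleTiltProp7BlendBond
import Literature.MathematicalPhysics.QuantumFieldTheory.Balaban1983to89.BlockAveragingSU2
import HarnessLib

/-!
# Route `UnitScaleTilt`, crux K1 child «MinimiserStabilityRegPr» (stmt-QuantumFields-19200), registered stub `stub_prop7From14` (skeleton birth_v7
# cc37a178…; leaf V3 «Prop 7 from a background (14)») — THE BLENDED COMB GAUGE AT THE d = 3 CARRIER, ONE BOND: the bond variable of the blend of the
# eight comb elements of the cell of `z`, taken between `z` and `z + e_μ` with the weights of `z` and of `z + e_μ`, is within `551088·(ε₀ + e₀)·L^{−(K−n)}` of `1`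

Cell `ym3-torus` ∕ fleet seat `ym-ust-19200-p1` (gen 9; HUMAN RULING D-0037, YM ladder rung R3).  WHY.  Brick 6 of the blended-comb-gauge line
(CARD-19200-V3-g9.md): the per-bond core of the sup bound, with the cell data of `z` (`Prop7BlendCells`), the corner estimates (`Prop7BlendCorners`) and
the group-side bond estimate (`Prop7BlendBond.blend_bond_le`) put together; the cell-crossing bookkeeping (the weights of `z + e_μ` read in ITS cell agree
with the ones used here, by the face values of the blend) and the packaging as a (4)-element are the next file.

WHAT IS PROVED (sorry-free, no definition).  `coe_inv_SU`, `dist1_mul_inv_eq`, `dist1_transport_eq`, `vec_mem01`;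
**`corner_family_T3`**, **`blend_bond_le_T3`**.

HONEST SCOPE.  Bookkeeping over landed estimates; count-neutral helper toward stmt-QuantumFields-19200 (`--supports`).

References: T. Bałaban, CMP 102 (1985) 277–309 [Balaban1985Variational] ((4) p.278, (18) p.280); CMP 99 (1985) 75–102 [Balaban1985RegularSpaces]
(Lemma 1 p.79, p.80).
-/

noncomputable section

open NormedSpace
open scoped Matrix.Norms.L2Operator

namespace Summit.QuantumFields.YangMills.Theorems.Prop7BlendSite

open Literature.MathematicalPhysics.QuantumFieldTheory.Balaban1983to89
open T4Continuum BlockAveraging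
open B10Eq27TorusAxialLog (axialT rel transl)
open B7Prop1Explicit renaming Site → LSite
open B5Eq118OneStroke (iterBlockOf)
open B15DeterminingSets (embIter)
open MatrixLog (mlog)
open Literature.MathematicalPhysics.QuantumFieldTheory.Balaban1983to89.T3ContinuumYM3Torus
open Literature.MathematicalPhysics.QuantumFieldTheory.Balaban1983to89.T3RegularMinimiser (regThreshold)
open Literature.MathematicalPhysics.QuantumFieldTheory.Balaban1983to89.T3PrintedRegularMinimiser (RegPr RegPr.plaqSmall)
open Summit.QuantumFields.YangMills.Theorems.Prop7BlendCells
open Summit.QuantumFields.YangMills.Theorems.Prop7BlendCorners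
open Summit.QuantumFields.YangMills.Theorems.Prop7BlendBond

/-! ## §1 Bridges between `SU(2)` and `M₂(ℂ)` -/

/-- `↑(A⁻¹) = (↑A)*` in `SU(N)`. [folklore] -/
theorem coe_inv_SU {N : Type*} [DecidableEq N] [Fintype N] (A : Matrix.specialUnitaryGroup N ℂ) :
    ((A⁻¹ : Matrix.specialUnitaryGroup N ℂ) : Matrix N N ℂ) = star (A : Matrix N N ℂ) := by
  rw [← Matrix.star_eq_inv]; rfl

/-- `dist1(A·B⁻¹) = ‖↑A·(↑B)* − 1‖`. [cite: Balaban1985Averaging, (19) p.21] -/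
theorem dist1_mul_inv_eq (A B : Matrix.specialUnitaryGroup (Fin 2) ℂ) :
    dist1 (A * B⁻¹) = ‖(A : Matrix (Fin 2) (Fin 2) ℂ) * star (B : Matrix (Fin 2) (Fin 2) ℂ) - 1‖ := by
  rw [SU2Mean.dist1_eq_norm, Submonoid.coe_mul, coe_inv_SU]

/-- `dist1(A·X·B⁻¹·Y⁻¹) = ‖↑A·↑X·(↑B)*·(↑Y)* − 1‖`. [cite: Balaban1985Averaging, (19) p.21] -/
theorem dist1_transport_eq (A X B Y : Matrix.specialUnitaryGroup (Fin 2) ℂ) :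
    dist1 (A * X * B⁻¹ * Y⁻¹) = ‖(A : Matrix (Fin 2) (Fin 2) ℂ) * (X : Matrix (Fin 2) (Fin 2) ℂ) * star (B : Matrix (Fin 2) (Fin 2) ℂ) *
      star (Y : Matrix (Fin 2) (Fin 2) ℂ) - 1‖ := by
  rw [SU2Mean.dist1_eq_norm, Submonoid.coe_mul, Submonoid.coe_mul, Submonoid.coe_mul, coe_inv_SU, coe_inv_SU]

/-- The corner vector `(i, j, k) ∈ {0,1}³` read as a lattice vector lies in `{0,1}ᵈ`. [folklore] -/
theorem vec_mem01 {d : ℕ} (κ0 κ1 : Fin d) (i j k : Fin 2) (ν : Fin d) :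
    (fun ν : Fin d => if ν = κ0 then ((i : ℕ) : ℤ) else if ν = κ1 then ((j : ℕ) : ℤ) else ((k : ℕ) : ℤ)) ν = 0 ∨
    (fun ν : Fin d => if ν = κ0 then ((i : ℕ) : ℤ) else if ν = κ1 then ((j : ℕ) : ℤ) else ((k : ℕ) : ℤ)) ν = 1 := by
  have hi := i.isLt; have hj := j.isLt; have hk := k.isLt
  simp only
  split_ifs <;> omega

/-! ## §2 The bond estimate at the carrier -/

section T3

variable (F : T3Family) (n K : ℕ)

/-- **THE CORNER FAMILIES OF A BOND AT THE CARRIER**: for the cell `c` of `z` (positions `r`), the eight comb elements at `z` (`v`) and at `z + e_μ` (`w`,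
same corners, positions `r + e_μ`) are special unitary, each family is pairwise `3·(449/4)(ε₀ + e₀)`-close, and `v_ε·W_b·w_ε*·U₀,b*` is within
`3(ε₀ + e₀)L^{−(K−n)}` of `1`. [cite: Balaban1985Variational, (18) p.280; Balaban1985RegularSpaces, Lemma 1 (1.25) p.79] -/
theorem corner_family_T3 (hL : 7 ≤ F.L) {ε₀ e₀ : ℝ} (hε₀ : 0 < ε₀) (he₀ : 0 < e₀)
    (hε : 50 * (500 * (F.L : ℝ) + 7 * (F.L : ℝ) ^ 2) * ε₀ ≤ 1) (he : 50 * (500 * (F.L : ℝ) + 7 * (F.L : ℝ) ^ 2) * e₀ ≤ 1)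
    (W U₀ : GaugeField (F.P K) 0 (Matrix.specialUnitaryGroup (Fin 2) ℂ)) (hW : RegPr F n K ε₀ W) (hU₀ : RegPr F n K e₀ U₀)
    (hdesc : Averaging.iter (fun j => blockAvg (P := F.P K) (j := j) (ExpMeanLog.expMeanLogSU (n := Fin 2))) (K - n) W =
      Averaging.iter (fun j => blockAvg (P := F.P K) (j := j) (ExpMeanLog.expMeanLogSU (n := Fin 2))) (K - n) U₀)
    (hk : K - n ≤ (F.P K).m + (F.P K).K) (hN : 3 ≤ (F.P K).sitesPerDir (K - n)) {off : ℕ}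
    (hoff : ∀ (y : Site (F.P K) (K - n)) (μ : Fin (F.P K).d), ((embIter (K - n) y) μ).val = (y μ).val * (F.P K).L ^ (K - n) + off)
    (κ0 κ1 : Fin (F.P K).d) (z : Site (F.P K) 0) (μ : Fin (F.P K).d) :
    let c : Site (F.P K) (K - n) := iterBlockOf (K - n) (transl z (fun _ => -(off : ℤ)))
    let r : Fin (F.P K).d → ℕ := fun ν => ((transl z (fun _ => -(off : ℤ))) ν).val % F.L ^ (K - n)
    let vec : Fin 2 → Fin 2 → Fin 2 → LSite (F.P K).d :=
      fun i j k ν => if ν = κ0 then ((i : ℕ) : ℤ) else if ν = κ1 then ((j : ℕ) : ℤ) else ((k : ℕ) : ℤ)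
    let vE : Site (F.P K) 0 → Site (F.P K) (K - n) → Matrix (Fin 2) (Fin 2) ℂ :=
      fun x c' => (((axialT U₀ (embIter (K - n) c') x)⁻¹ * axialT W (embIter (K - n) c') x : Matrix.specialUnitaryGroup (Fin 2) ℂ) :
        Matrix (Fin 2) (Fin 2) ℂ)
    let v : Fin 2 → Fin 2 → Fin 2 → Matrix (Fin 2) (Fin 2) ℂ := fun i j k => vE z (transl c (vec i j k))
    let w : Fin 2 → Fin 2 → Fin 2 → Matrix (Fin 2) (Fin 2) ℂ := fun i j k => vE (z.shift μ) (transl c (vec i j k))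
    (∀ i j k, v i j k ∈ Matrix.specialUnitaryGroup (Fin 2) ℂ) ∧ (∀ i j k, w i j k ∈ Matrix.specialUnitaryGroup (Fin 2) ℂ) ∧
    (∀ i j k i' j' k', ‖v i j k * star (v i' j' k') - 1‖ ≤ 3 * ((449 / 4) * (ε₀ + e₀))) ∧
    (∀ i j k i' j' k', ‖w i j k * star (w i' j' k') - 1‖ ≤ 3 * ((449 / 4) * (ε₀ + e₀))) ∧
    (∀ i j k, ‖v i j k * ((W ⟨z, μ⟩ : Matrix.specialUnitaryGroup (Fin 2) ℂ) : Matrix (Fin 2) (Fin 2) ℂ) * star (w i j k) *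
      star ((U₀ ⟨z, μ⟩ : Matrix.specialUnitaryGroup (Fin 2) ℂ) : Matrix (Fin 2) (Fin 2) ℂ) - 1‖ ≤ 3 * (ε₀ + e₀) * (((F.L : ℝ))⁻¹) ^ (K - n)) ∧
    (∀ κ, r κ < F.L ^ (K - n)) := by
  intro c r vec vE v w
  set r' : Fin (F.P K).d → ℕ := fun ν => r ν + if ν = μ then 1 else 0 with hr'def
  have hLL : (F.P K).L = F.L := rfl
  have hpos : 0 < F.L ^ (K - n) := pow_pos (by omega) _
  have hvec : ∀ i j k ν, vec i j k ν = 0 ∨ vec i j k ν = 1 := fun i j k ν => vec_mem01 κ0 κ1 i j k ν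
  have hform : ∀ ε : LSite (F.P K).d, (∀ ν, ε ν = 0 ∨ ε ν = 1) → ∀ κ,
      rel (embIter (K - n) (transl c ε)) z κ = ((r κ : ℕ) : ℤ) - ε κ * ((F.L ^ (K - n) : ℕ) : ℤ) := by
    intro ε hε' κ
    have := rel_corner_eq hk hN hoff z ε hε' κ
    rw [hLL] at this; exact this
  have hform' : ∀ ε : LSite (F.P K).d, (∀ ν, ε ν = 0 ∨ ε ν = 1) → ∀ κ,
      rel (embIter (K - n) (transl c ε)) (z.shift μ) κ = ((r' κ : ℕ) : ℤ) - ε κ * ((F.L ^ (K - n) : ℕ) : ℤ) := by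
    intro ε hε' κ
    have := rel_corner_shift_eq hk hN hoff z ε hε' μ κ
    rw [hLL] at this
    rw [this]
    simp only [hr'def, r]
    by_cases hκ : κ = μ
    · rw [if_pos hκ, if_pos hκ]; push_cast; ring
    · rw [if_neg hκ, if_neg hκ]; push_cast; ring
  have hrlt : ∀ κ, r κ < F.L ^ (K - n) := fun κ => Nat.mod_lt _ hpos
  have hρ : ∀ κ, (0 : ℤ) ≤ ((r κ : ℕ) : ℤ) ∧ ((r κ : ℕ) : ℤ) ≤ F.L ^ (K - n) := fun κ =>
    ⟨by positivity, by exact_mod_cast (hrlt κ).le⟩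
  have hr'le : ∀ κ, r' κ ≤ F.L ^ (K - n) := by
    intro κ; have h1 := hrlt κ; show r κ + (if κ = μ then 1 else 0) ≤ _; split_ifs <;> omega
  have hρ' : ∀ κ, (0 : ℤ) ≤ ((r' κ : ℕ) : ℤ) ∧ ((r' κ : ℕ) : ℤ) ≤ F.L ^ (K - n) := fun κ =>
    ⟨by positivity, by exact_mod_cast hr'le κ⟩
  refine ⟨fun i j k => Subtype.coe_prop _, fun i j k => Subtype.coe_prop _, ?_, ?_, ?_, hrlt⟩
  · intro i j k i' j' k'
    have hpair := dist1_corner_pair_le_T3 F n K hL hε₀ he₀ hε he W U₀ hW hU₀ hdesc c z (fun κ => ((r κ : ℕ) : ℤ))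
      (fun κ => by exact_mod_cast hρ κ) hform (vec i j k) (vec i' j' k') (hvec i j k) (hvec i' j' k')
    rwa [dist1_mul_inv_eq] at hpair
  · intro i j k i' j' k'
    have hpair := dist1_corner_pair_le_T3 F n K hL hε₀ he₀ hε he W U₀ hW hU₀ hdesc c (z.shift μ) (fun κ => ((r' κ : ℕ) : ℤ))
      (fun κ => by exact_mod_cast hρ' κ) hform' (vec i j k) (vec i' j' k') (hvec i j k) (hvec i' j' k')
    rwa [dist1_mul_inv_eq] at hpair
  · intro i j k
    have ht := dist1_corner_transport_le_T3 F n K hk hN hoff hε₀.le he₀.le W U₀ hW hU₀ z (vec i j k) (hvec i j k) μ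
    rwa [dist1_transport_eq] at ht

/-- **THE BLENDED BOND VARIABLE AT THE CARRIER.**  `L ≥ 7`; `W ∈ 𝔘_k(ε₀)`, `U₀ ∈ 𝔘_k(e₀)` (plaquette clause of (2)) with the same `(K−n)`-fold
(0.4)-average; `50(500L + 7L²)e ≤ 1` for both radii and `538800(ε₀ + e₀) ≤ 1`; `off` the uniform centre offset; coordinates `κ0, κ1, κ2`.  For the cell
`c` of `z` with positions `r_ν = (z − off)_ν mod L^k`, the trilinear geodesic blend `B` of the eight comb elements `v_ε(·) = U₀(Γ_{y_ε,·})⁻¹W(Γ_{y_ε,·})`,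
`y_ε = embIter (c + ε)`, `ε = (i,j,k)` read in the coordinates `κ0, κ1, κ2`, taken at `z` with weights `r/L^k` and at `z + e_μ` with weights
`(r + e_μ)/L^k`, has bond variable `‖B_z·W_b·B_{z+e_μ}*·U₀,b* − 1‖ ≤ 551088·(ε₀ + e₀)·L^{−(K−n)}`, `b = ⟨z, μ⟩` — uniformly in `k = K − n` and in the
volume. [cite: Balaban1985Variational, (18) p.280; Balaban1985RegularSpaces, Lemma 1 (1.25) p.79] -/
theorem blend_bond_le_T3 (hL : 7 ≤ F.L) {ε₀ e₀ : ℝ} (hε₀ : 0 < ε₀) (he₀ : 0 < e₀)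
    (hε : 50 * (500 * (F.L : ℝ) + 7 * (F.L : ℝ) ^ 2) * ε₀ ≤ 1) (he : 50 * (500 * (F.L : ℝ) + 7 * (F.L : ℝ) ^ 2) * e₀ ≤ 1)
    (hsmall : 538800 * (ε₀ + e₀) ≤ 1)
    (W U₀ : GaugeField (F.P K) 0 (Matrix.specialUnitaryGroup (Fin 2) ℂ)) (hW : RegPr F n K ε₀ W) (hU₀ : RegPr F n K e₀ U₀)
    (hdesc : Averaging.iter (fun j => blockAvg (P := F.P K) (j := j) (ExpMeanLog.expMeanLogSU (n := Fin 2))) (K - n) W =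
      Averaging.iter (fun j => blockAvg (P := F.P K) (j := j) (ExpMeanLog.expMeanLogSU (n := Fin 2))) (K - n) U₀)
    (hk : K - n ≤ (F.P K).m + (F.P K).K) (hN : 3 ≤ (F.P K).sitesPerDir (K - n)) {off : ℕ}
    (hoff : ∀ (y : Site (F.P K) (K - n)) (μ : Fin (F.P K).d), ((embIter (K - n) y) μ).val = (y μ).val * (F.P K).L ^ (K - n) + off)
    (κ0 κ1 κ2 : Fin (F.P K).d) (h01 : κ0 ≠ κ1) (h02 : κ0 ≠ κ2) (h12 : κ1 ≠ κ2) (z : Site (F.P K) 0) (μ : Fin (F.P K).d) :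
    let c : Site (F.P K) (K - n) := iterBlockOf (K - n) (transl z (fun _ => -(off : ℤ)))
    let r : Fin (F.P K).d → ℕ := fun ν => ((transl z (fun _ => -(off : ℤ))) ν).val % F.L ^ (K - n)
    let r' : Fin (F.P K).d → ℕ := fun ν => r ν + if ν = μ then 1 else 0
    let vec : Fin 2 → Fin 2 → Fin 2 → LSite (F.P K).d :=
      fun i j k ν => if ν = κ0 then ((i : ℕ) : ℤ) else if ν = κ1 then ((j : ℕ) : ℤ) else ((k : ℕ) : ℤ)
    let vE : Site (F.P K) 0 → Site (F.P K) (K - n) → Matrix (Fin 2) (Fin 2) ℂ :=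
      fun x c' => (((axialT U₀ (embIter (K - n) c') x)⁻¹ * axialT W (embIter (K - n) c') x : Matrix.specialUnitaryGroup (Fin 2) ℂ) :
        Matrix (Fin 2) (Fin 2) ℂ)
    let v : Fin 2 → Fin 2 → Fin 2 → Matrix (Fin 2) (Fin 2) ℂ := fun i j k => vE z (transl c (vec i j k))
    let w : Fin 2 → Fin 2 → Fin 2 → Matrix (Fin 2) (Fin 2) ℂ := fun i j k => vE (z.shift μ) (transl c (vec i j k))
    let G : ℝ → Matrix (Fin 2) (Fin 2) ℂ → Matrix (Fin 2) (Fin 2) ℂ → Matrix (Fin 2) (Fin 2) ℂ :=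
      fun t a b => exp (((t : ℂ)) • mlog (b * star a)) * a
    let h : ℝ := (F.L : ℝ) ^ (K - n)
    ‖G (r κ2 / h) (G (r κ1 / h) (G (r κ0 / h) (v 0 0 0) (v 1 0 0)) (G (r κ0 / h) (v 0 1 0) (v 1 1 0)))
          (G (r κ1 / h) (G (r κ0 / h) (v 0 0 1) (v 1 0 1)) (G (r κ0 / h) (v 0 1 1) (v 1 1 1))) *
        ((W ⟨z, μ⟩ : Matrix.specialUnitaryGroup (Fin 2) ℂ) : Matrix (Fin 2) (Fin 2) ℂ) *
        star (G (r' κ2 / h) (G (r' κ1 / h) (G (r' κ0 / h) (w 0 0 0) (w 1 0 0)) (G (r' κ0 / h) (w 0 1 0) (w 1 1 0)))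
          (G (r' κ1 / h) (G (r' κ0 / h) (w 0 0 1) (w 1 0 1)) (G (r' κ0 / h) (w 0 1 1) (w 1 1 1)))) *
        star ((U₀ ⟨z, μ⟩ : Matrix.specialUnitaryGroup (Fin 2) ℂ) : Matrix (Fin 2) (Fin 2) ℂ) - 1‖ ≤
      551088 * (ε₀ + e₀) * (((F.L : ℝ))⁻¹) ^ (K - n) := by
  intro c r r' vec vE v w G h
  have hL0 : (0 : ℝ) < (F.L : ℝ) := by exact_mod_cast (show 0 < F.L by omega)
  have hh : 0 < h := pow_pos hL0 _
  have hsum : 0 ≤ ε₀ + e₀ := by linarith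
  obtain ⟨hvSU, hwSU, hvv, hww, htr, hrlt⟩ :=
    corner_family_T3 F n K hL hε₀ he₀ hε he W U₀ hW hU₀ hdesc hk hN hoff κ0 κ1 z μ
  have hvU : ∀ i j k, v i j k ∈ Matrix.unitaryGroup (Fin 2) ℂ := fun i j k => (Matrix.mem_specialUnitaryGroup_iff.1 (hvSU i j k)).1
  have hwU : ∀ i j k, w i j k ∈ Matrix.unitaryGroup (Fin 2) ℂ := fun i j k => (Matrix.mem_specialUnitaryGroup_iff.1 (hwSU i j k)).1
  set D : ℝ := 3 * ((449 / 4) * (ε₀ + e₀)) with hDdef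
  set ρ : ℝ := 3 * (ε₀ + e₀) * (((F.L : ℝ))⁻¹) ^ (K - n) with hρdef
  have hr'le : ∀ κ, r' κ ≤ F.L ^ (K - n) := by
    intro κ; have h1 : r κ < F.L ^ (K - n) := hrlt κ; show r κ + (if κ = μ then 1 else 0) ≤ _; split_ifs <;> omega
  -- numerics
  have hη1 : (((F.L : ℝ))⁻¹) ^ (K - n) ≤ 1 := pow_le_one₀ (inv_nonneg.mpr hL0.le) (inv_le_one_of_one_le₀ (by exact_mod_cast (show 1 ≤ F.L by omega)))
  have hηpos : 0 < (((F.L : ℝ))⁻¹) ^ (K - n) := pow_pos (inv_pos.mpr hL0) _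
  have hD : D ≤ 1 / 1600 := by rw [hDdef]; nlinarith
  have hρb : ρ ≤ 1 / 4096 := by
    rw [hρdef]
    calc 3 * (ε₀ + e₀) * (((F.L : ℝ))⁻¹) ^ (K - n) ≤ 3 * (ε₀ + e₀) * 1 := by gcongr
      _ ≤ 1 / 4096 := by nlinarith
  -- weights
  have ht0 : ∀ κ, 0 ≤ (r κ : ℝ) / h := fun κ => by positivity
  have ht1 : ∀ κ, (r κ : ℝ) / h ≤ 1 := fun κ => by
    rw [div_le_one hh]; show ((r κ : ℕ) : ℝ) ≤ (F.L : ℝ) ^ (K - n); exact_mod_cast (hrlt κ).le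
  have hs0 : ∀ κ, 0 ≤ (r' κ : ℝ) / h := fun κ => by positivity
  have hs1 : ∀ κ, (r' κ : ℝ) / h ≤ 1 := fun κ => by
    rw [div_le_one hh]; show ((r' κ : ℕ) : ℝ) ≤ (F.L : ℝ) ^ (K - n); exact_mod_cast hr'le κ
  have hdiff : ∀ κ, |(r κ : ℝ) / h - (r' κ : ℝ) / h| = (if κ = μ then 1 else 0) / h := by
    intro κ
    by_cases hκ : κ = μ
    · simp only [r', if_pos hκ]; push_cast
      rw [show ((r κ : ℕ) : ℝ) / h - (((r κ : ℕ) : ℝ) + 1) / h = -(1 / h) by ring, abs_neg, abs_of_pos (by positivity)]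
    · simp only [r', if_neg hκ, add_zero, sub_self, abs_zero, zero_div]
  have hind : (if κ0 = μ then (1 : ℝ) else 0) + (if κ1 = μ then (1 : ℝ) else 0) + (if κ2 = μ then (1 : ℝ) else 0) ≤ 1 := by
    by_cases h0 : κ0 = μ
    · have h1 : ¬ κ1 = μ := fun h1 => h01 (h0.trans h1.symm)
      have h2 : ¬ κ2 = μ := fun h2 => h02 (h0.trans h2.symm)
      rw [if_pos h0, if_neg h1, if_neg h2]; norm_num
    · by_cases h1 : κ1 = μ
      · have h2 : ¬ κ2 = μ := fun h2 => h12 (h1.trans h2.symm)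
        rw [if_neg h0, if_pos h1, if_neg h2]; norm_num
      · rw [if_neg h0, if_neg h1]; split_ifs <;> norm_num
  have hsumdiff : |(r κ0 : ℝ) / h - (r' κ0 : ℝ) / h| + |(r κ1 : ℝ) / h - (r' κ1 : ℝ) / h| + |(r κ2 : ℝ) / h - (r' κ2 : ℝ) / h| ≤ 1 / h := by
    rw [hdiff κ0, hdiff κ1, hdiff κ2, ← add_div, ← add_div]
    exact div_le_div_of_nonneg_right hind hh.le
  -- the group-side bond estimate
  have hmain := blend_bond_le v w hvU hwU hD hvv hww
    (Matrix.mem_specialUnitaryGroup_iff.1 (Subtype.coe_prop (W ⟨z, μ⟩))).1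
    (Matrix.mem_specialUnitaryGroup_iff.1 (Subtype.coe_prop (U₀ ⟨z, μ⟩))).1 hρb htr
    (ht0 κ0) (ht1 κ0) (ht0 κ1) (ht1 κ1) (ht0 κ2) (ht1 κ2) (hs0 κ0) (hs1 κ0) (hs0 κ1) (hs1 κ1) (hs0 κ2) (hs1 κ2)
  refine hmain.trans ?_
  -- `1600·(3/h)·D + 4096ρ ≤ 551088(ε₀+e₀)η` (`1/h = η`)
  have hinv : 1 / h = (((F.L : ℝ))⁻¹) ^ (K - n) := by rw [one_div, ← inv_pow]
  have hD0 : 0 ≤ D := by rw [hDdef]; positivity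
  calc 1600 * (|(r κ0 : ℝ) / h - (r' κ0 : ℝ) / h| + |(r κ1 : ℝ) / h - (r' κ1 : ℝ) / h| + |(r κ2 : ℝ) / h - (r' κ2 : ℝ) / h|) * D + 4096 * ρ
      ≤ 1600 * (1 / h) * D + 4096 * ρ := by gcongr
    _ = 551088 * (ε₀ + e₀) * (((F.L : ℝ))⁻¹) ^ (K - n) := by rw [hDdef, hρdef, hinv]; ring

end T3

end Summit.QuantumFields.YangMills.Theorems.Prop7BlendSite

end
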